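import Summits.QuantumFields.YangMills.Theorems.DiagonalMirrorRPRWilsonDiagonalModelReweight

/-!
# Crux `WeakCouplingHypercubicLimitRP` (stmt-QuantumFields-27398) / aside `DiagonalMirrorRPR` (stmt-QuantumFields-10604), door B,
# construction F1_diag — PAIRING LAYER, step P3a: the LINK KERNEL `c(V, Y, V′)` of the reweighted lifted chain

Helper file (`--supports stmt-QuantumFields-27398 --as helper`) of the hand `hand-10604-wilsonDiagModel-3` (docket director-ym g23,
R695/R701-ym, O4 WORD 30: step P3 (sandwich / positivity) of hand-1's ROADMAP-F1diag v4 §1⅞ and hand-2's addendum v5); it closes nothing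
by itself.

WHAT.  The cyclic integrals of the bounded reweighted kernel `𝔟 = bKernel ρ β M` (hand-1, `…Reweight`) are obtained from the pair chain
`∏_t e^{β even_t} e^{β odd_t}` by expanding every even half step through the feature lift and integrating out every bond half layer `Y`.
For the PAIRING identities the bond half layers inside the support of the inserted observable must NOT be integrated out, so the
chain is needed one level below `𝔟`: with the site weight `ẽ(k, X) = e^{β inslab(X)/2} / √w_k` (`siteWeight`) the **link kernel**

  `c((k,X), Y, (k′,X′)) = ẽ(k,X) ẽ(k′,X′) · ψ_k(w(ΘY)) · e^{β odd(X, Y, X′)} · ψ_{k′}(w(Y))`   (`linkKer`)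

is the integrand of `𝔟`: `∫ c(V, Y, V′) dY = 𝔟(V, V′)` (`integral_linkKer`).  It is bounded (`exists_abs_linkKer_le`: `|ψ_k(w)| ≤ √w_k`),
jointly measurable (`measurable_linkKer`), continuous in the half layers (`continuous_linkKer`), and — the kernel-level form of reflection
positivity's time reversal — **Θ-reversible**: `c(V′, ΘY, V) = c(V, Y, V′)` (`linkKer_reverse`, from `oddActionU_reverse`).  Finally
`prod_linkKer_mul_prod_featWeight` identifies, for any finite index type with a successor PERMUTATION `σ`, the summand of hand-1's
feature expansion `hasSum_chainIntegrand` with `(∏_i w_{k_i}) · ∏_i c(V_i, Y_{σ i}, V_{σ i})` — the weights `∏ w_{k_i}` are exactly the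
atoms of the discrete factor of `μ̃ = (w·count) ⊗ halfHaar`, so the pair chain lifts to the `c`-chain over `μ̃` (next file, `…MasterLift`).

HONEST FRAMING: bookkeeping only; `wilsonDiagonalModel` is NOT landed here; no letter is proved; D1, ⟨27398⟩, S6i and the aside ⟨10604⟩ are
OPEN; nothing here bears on the summit; the Yang–Mills mass gap is NOT proved here or anywhere in the tree.  Two plumbing definitions
(`siteWeight`, `linkKer`; real-valued), no `Prop` definition, no instance, no notation, `autoImplicit false`.

References: K. Osterwalder, E. Seiler, Ann. Phys. 110 (1978) §2–3; E. Seiler, LNP 159 (1982) Ch. 2.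
-/

set_option autoImplicit false

noncomputable section

open scoped BigOperators ENNReal
open MeasureTheory Function
open Literature.MathematicalPhysics.QuantumLattice Literature.MathematicalPhysics.QuantumFieldTheory
open Summit.QuantumFields.YangMills.Cruxes.DiagonalMirrorRPR.ParityBridgeColdTraces

namespace Summit.QuantumFields.YangMills.Cruxes.DiagonalMirrorRPR.SignTwistedDiagonalTrace.WilsonDiagonal

/-! ## §1 The site weight and the link kernel -/

section LinkKernel

variable {S : ℕ} [NeZero S] {G : Type} [Group G] {Nc : ℕ} (ρ : G →* Matrix (Fin Nc) (Fin Nc) ℂ)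

/-- The site weight `ẽ(k, X) = e^{β inslab(X)/2} / √w_k` of a lifted state `(k, X) ∈ ℕ × HalfCfg`: the square root of the
`e^{β inslab}` factor of the even half step shared between the two bonds at the site, divided by the square root of the reweighting
weight `w_k = featWeight`. -/
def siteWeight (β M : ℝ) (v : ℕ × HalfCfg S S G) : ℝ :=
  Real.exp (β / 2 * inslabAction ρ v.2) / Real.sqrt (featWeight (featDim S Nc) β M v.1)

/-- `ẽ > 0`. -/
theorem siteWeight_pos (β M : ℝ) (v : ℕ × HalfCfg S S G) : 0 < siteWeight ρ β M v :=
  div_pos (Real.exp_pos _) (Real.sqrt_pos.2 (featWeight_pos _ β M v.1))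

/-- `ẽ(k,X)² · w_k = e^{β inslab(X)}`. -/
theorem siteWeight_sq_mul_featWeight (β M : ℝ) (v : ℕ × HalfCfg S S G) :
    siteWeight ρ β M v * siteWeight ρ β M v * featWeight (featDim S Nc) β M v.1 =
      Real.exp (β * inslabAction ρ v.2) := by
  have hw := featWeight_pos (featDim S Nc) β M v.1
  have hsq : Real.sqrt (featWeight (featDim S Nc) β M v.1) * Real.sqrt (featWeight (featDim S Nc) β M v.1) =
      featWeight (featDim S Nc) β M v.1 := Real.mul_self_sqrt hw.le
  have hs : Real.sqrt (featWeight (featDim S Nc) β M v.1) ≠ 0 := (Real.sqrt_pos.2 hw).ne'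
  unfold siteWeight
  rw [div_mul_div_comm, hsq, div_mul_cancel₀ _ hw.ne', ← Real.exp_add]
  congr 1; ring

variable [TopologicalSpace G] [IsTopologicalGroup G] [CompactSpace G] [MeasurableSpace G] [BorelSpace G]

/-- **The link kernel** `c((k,X), Y, (k′,X′)) = ẽ(k,X) ẽ(k′,X′) · ψ_k(w(ΘY)) · e^{β odd(X, Y, X′)} · ψ_{k′}(w(Y))`: the integrand, in
the bond half layer `Y` carried by the bond `(k,X) → (k′,X′)`, of the reweighted lifted kernel `𝔟` (`integral_linkKer`). -/
def linkKer (β M : ℝ) (v : ℕ × HalfCfg S S G) (Y : HalfCfg S S G) (v' : ℕ × HalfCfg S S G) : ℝ :=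
  siteWeight ρ β M v * siteWeight ρ β M v' *
    (natFeature (p := featDim S Nc) β v.1 (bondVec ρ (thetaHalf Y)) * Real.exp (β * oddActionU ρ v.2 Y v'.2) *
      natFeature (p := featDim S Nc) β v'.1 (bondVec ρ Y))

omit [TopologicalSpace G] [IsTopologicalGroup G] [CompactSpace G] [MeasurableSpace G] [BorelSpace G] in
/-- **Θ-reversibility of the link kernel** (time reversal at kernel level): `c(V′, ΘY, V) = c(V, Y, V′)` — `Θ` is an involution
and the odd half step is Θ-pseudo-symmetric (`oddActionU_reverse`). -/
theorem linkKer_reverse (β M : ℝ) (v v' : ℕ × HalfCfg S S G) (Y : HalfCfg S S G) :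
    linkKer ρ β M v' (thetaHalf Y) v = linkKer ρ β M v Y v' := by
  unfold linkKer
  rw [thetaHalf_thetaHalf, oddActionU_reverse]
  ring

/-- **`∫ c(V, Y, V′) dY = 𝔟(V, V′)`**: the link kernel integrates, over its bond half layer, to the reweighted lifted kernel. -/
theorem integral_linkKer (β M : ℝ) (v v' : ℕ × HalfCfg S S G) :
    ∫ Y, linkKer ρ β M v Y v' ∂(halfHaar S G) = bKernel ρ β M v v' := by
  unfold linkKer bKernel natKernel siteWeight
  rw [integral_const_mul, div_mul_div_comm, div_mul_eq_mul_div]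

omit [CompactSpace G] [MeasurableSpace G] [BorelSpace G] in
/-- The link kernel is continuous in its three half layers (fixed feature indices). -/
theorem continuous_linkKer (hρ : Continuous ρ) (β M : ℝ) (k k' : ℕ) :
    Continuous fun t : HalfCfg S S G × HalfCfg S S G × HalfCfg S S G => linkKer ρ β M (k, t.1) t.2.1 (k', t.2.2) := by
  have hins : Continuous fun X : HalfCfg S S G => Real.exp (β / 2 * inslabAction ρ X) := by
    refine Real.continuous_exp.comp (continuous_const.mul ?_)
    unfold inslabAction
    refine continuous_finsetSum _ fun s _ => Complex.continuous_re.comp (Continuous.matrix_trace (hρ.comp ?_))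
    fun_prop
  have hsw : ∀ k₀ : ℕ, Continuous fun X : HalfCfg S S G => siteWeight ρ β M (k₀, X) := fun k₀ => by
    show Continuous fun X : HalfCfg S S G =>
      Real.exp (β / 2 * inslabAction ρ X) / Real.sqrt (featWeight (featDim S Nc) β M k₀)
    exact hins.div_const _
  have hodd : Continuous fun t : HalfCfg S S G × HalfCfg S S G × HalfCfg S S G =>
      Real.exp (β * oddActionU ρ t.1 t.2.1 t.2.2) :=
    Real.continuous_exp.comp (continuous_const.mul (continuous_oddActionU ρ hρ))
  have hA : Continuous fun t : HalfCfg S S G × HalfCfg S S G × HalfCfg S S G =>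
      natFeature (p := featDim S Nc) β k (bondVec ρ (thetaHalf t.2.1)) :=
    ((continuous_natFeature_bondVec ρ hρ β k).comp continuous_thetaHalf).comp (continuous_fst.comp continuous_snd)
  have hB : Continuous fun t : HalfCfg S S G × HalfCfg S S G × HalfCfg S S G =>
      natFeature (p := featDim S Nc) β k' (bondVec ρ t.2.1) :=
    (continuous_natFeature_bondVec ρ hρ β k').comp (continuous_fst.comp continuous_snd)
  unfold linkKer
  exact (((hsw k).comp continuous_fst).mul ((hsw k').comp (continuous_snd.comp continuous_snd))).mul
    ((hA.mul hodd).mul hB)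

omit [MeasurableSpace G] [BorelSpace G] in
/-- **The link kernel is bounded** (`|ψ_k(w(Y))| ≤ √w_k` as `|w(Y)_j| ≤ M`, the two half-step weights are bounded):
`|c| ≤ C` uniformly. -/
theorem exists_abs_linkKer_le (hρ : Continuous ρ) (β : ℝ) {M : ℝ}
    (hM : ∀ (Y : HalfCfg S S G) (j : Fin (featDim S Nc)), |bondVec ρ Y j| ≤ M) :
    ∃ C : ℝ, 0 ≤ C ∧ ∀ (v : ℕ × HalfCfg S S G) (Y : HalfCfg S S G) (v' : ℕ × HalfCfg S S G), |linkKer ρ β M v Y v'| ≤ C := by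
  obtain ⟨Co, hCo, hodd⟩ := exists_exp_oddActionU_le (S := S) ρ hρ β
  obtain ⟨Ci, hCi, hins⟩ := exists_exp_inslabAction_le (S := S) ρ hρ β
  refine ⟨Ci * Ci * Co, by positivity, fun v Y v' => ?_⟩
  have hw := fun k => featWeight_pos (featDim S Nc) β M k
  have hψ : ∀ (k : ℕ) (Z : HalfCfg S S G),
      |natFeature (p := featDim S Nc) β k (bondVec ρ Z)| / Real.sqrt (featWeight (featDim S Nc) β M k) ≤ 1 := fun k Z => by
    rw [div_le_one (Real.sqrt_pos.2 (hw k))]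
    exact abs_natFeature_le_sqrt_featWeight β k fun j => hM Z j
  have hkey : |linkKer ρ β M v Y v'| =
      Real.exp (β / 2 * inslabAction ρ v.2) * Real.exp (β / 2 * inslabAction ρ v'.2) *
        Real.exp (β * oddActionU ρ v.2 Y v'.2) *
        ((|natFeature (p := featDim S Nc) β v.1 (bondVec ρ (thetaHalf Y))| / Real.sqrt (featWeight (featDim S Nc) β M v.1)) *
          (|natFeature (p := featDim S Nc) β v'.1 (bondVec ρ Y)| / Real.sqrt (featWeight (featDim S Nc) β M v'.1))) := by
    unfold linkKer siteWeight
    rw [abs_mul, abs_mul, abs_mul, abs_mul, abs_div, abs_div, abs_of_pos (Real.exp_pos _), abs_of_pos (Real.exp_pos _),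
      abs_of_pos (Real.exp_pos _), abs_of_pos (Real.sqrt_pos.2 (hw _)), abs_of_pos (Real.sqrt_pos.2 (hw _))]
    ring
  rw [hkey]
  have h1 := mul_le_mul (hψ v.1 (thetaHalf Y)) (hψ v'.1 Y) (by positivity) zero_le_one
  rw [mul_one] at h1
  calc Real.exp (β / 2 * inslabAction ρ v.2) * Real.exp (β / 2 * inslabAction ρ v'.2) *
        Real.exp (β * oddActionU ρ v.2 Y v'.2) * _
      ≤ Ci * Ci * Co * 1 := by
        refine mul_le_mul (mul_le_mul (mul_le_mul (hins _) (hins _) (Real.exp_pos _).le hCi.le) (hodd _ _ _)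
          (Real.exp_pos _).le (by positivity)) h1 (by positivity) (by positivity)
    _ = Ci * Ci * Co := mul_one _

omit [TopologicalSpace G] [IsTopologicalGroup G] [CompactSpace G] [MeasurableSpace G] [BorelSpace G] in
/-- **The feature-expanded pair chain in terms of the link kernel.**  For a finite index type with a successor PERMUTATION `σ` and
lifted data `(k_i, X_i)`, bond half layers `Y_i`: the summand of hand-1's expansion `hasSum_chainIntegrand`,
`∏_i e^{β inslab X_i} ψ_{k_i}(w(ΘY_{σ i})) ψ_{k_i}(w(Y_i)) e^{β odd(X_i, Y_{σ i}, X_{σ i})}`, equals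
`(∏_i c((k_i,X_i), Y_{σ i}, (k_{σ i}, X_{σ i}))) · ∏_i w_{k_i}` (re-index the factor `ψ_{k_i}(w(Y_i))` along `σ`; `ẽ² w = e^{β inslab}`). -/
theorem prod_linkKer_mul_prod_featWeight (β M : ℝ) {ι : Type*} [Fintype ι] (σ : ι ≃ ι) (k : ι → ℕ)
    (X Y : ι → HalfCfg S S G) :
    (∏ i, linkKer ρ β M (k i, X i) (Y (σ i)) (k (σ i), X (σ i))) * ∏ i, featWeight (featDim S Nc) β M (k i) =
      ∏ i, Real.exp (β * inslabAction ρ (X i)) *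
        (natFeature (p := featDim S Nc) β (k i) (bondVec ρ (thetaHalf (Y (σ i)))) *
          natFeature (p := featDim S Nc) β (k i) (bondVec ρ (Y i))) *
        Real.exp (β * oddActionU ρ (X i) (Y (σ i)) (X (σ i))) := by
  -- re-index the two `σ`-shifted single-site factors
  have h1 : ∏ i, siteWeight ρ β M (k (σ i), X (σ i)) = ∏ i, siteWeight ρ β M (k i, X i) :=
    Fintype.prod_equiv σ _ _ fun _ => rfl
  have h2 : ∏ i, natFeature (p := featDim S Nc) β (k (σ i)) (bondVec ρ (Y (σ i))) =
      ∏ i, natFeature (p := featDim S Nc) β (k i) (bondVec ρ (Y i)) :=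
    Fintype.prod_equiv σ (fun i => natFeature (p := featDim S Nc) β (k (σ i)) (bondVec ρ (Y (σ i)))) _ fun _ => rfl
  have h3 : ∀ i, siteWeight ρ β M (k i, X i) * siteWeight ρ β M (k i, X i) * featWeight (featDim S Nc) β M (k i) =
      Real.exp (β * inslabAction ρ (X i)) := fun i => siteWeight_sq_mul_featWeight ρ β M (k i, X i)
  calc (∏ i, linkKer ρ β M (k i, X i) (Y (σ i)) (k (σ i), X (σ i))) * ∏ i, featWeight (featDim S Nc) β M (k i)
      = (∏ i, siteWeight ρ β M (k i, X i)) * (∏ i, siteWeight ρ β M (k (σ i), X (σ i))) *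
          (∏ i, featWeight (featDim S Nc) β M (k i)) *
          ((∏ i, natFeature (p := featDim S Nc) β (k i) (bondVec ρ (thetaHalf (Y (σ i))))) *
            (∏ i, Real.exp (β * oddActionU ρ (X i) (Y (σ i)) (X (σ i)))) *
            ∏ i, natFeature (p := featDim S Nc) β (k (σ i)) (bondVec ρ (Y (σ i)))) := by
        simp only [linkKer, Finset.prod_mul_distrib]; ring
    _ = (∏ i, siteWeight ρ β M (k i, X i) * siteWeight ρ β M (k i, X i) * featWeight (featDim S Nc) β M (k i)) *
          ((∏ i, natFeature (p := featDim S Nc) β (k i) (bondVec ρ (thetaHalf (Y (σ i))))) *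
            (∏ i, Real.exp (β * oddActionU ρ (X i) (Y (σ i)) (X (σ i)))) *
            ∏ i, natFeature (p := featDim S Nc) β (k i) (bondVec ρ (Y i))) := by
        rw [h1, h2, Finset.prod_mul_distrib, Finset.prod_mul_distrib]
    _ = _ := by
        simp only [h3, ← Finset.prod_mul_distrib]
        refine Finset.prod_congr rfl fun i _ => ?_
        ring

variable [SecondCountableTopology G]

omit [CompactSpace G] in
/-- The link kernel is jointly measurable on `(ℕ × HalfCfg) × HalfCfg × (ℕ × HalfCfg)` (countable discrete factors, continuity in
the half layers). -/
theorem measurable_linkKer (hρ : Continuous ρ) (β M : ℝ) :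
    Measurable fun p : (ℕ × HalfCfg S S G) × HalfCfg S S G × (ℕ × HalfCfg S S G) => linkKer ρ β M p.1 p.2.1 p.2.2 := by
  have hg : Measurable fun q : (HalfCfg S S G × HalfCfg S S G × HalfCfg S S G) × (ℕ × ℕ) =>
      linkKer ρ β M (q.2.1, q.1.1) q.1.2.1 (q.2.2, q.1.2.2) := by
    refine measurable_from_prod_countable_left fun kk' => ?_
    exact (continuous_linkKer ρ hρ β M kk'.1 kk'.2).measurable
  have he : Measurable fun p : (ℕ × HalfCfg S S G) × HalfCfg S S G × (ℕ × HalfCfg S S G) =>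
      ((p.1.2, p.2.1, p.2.2.2), (p.1.1, p.2.2.1)) :=
    (measurable_fst.snd.prodMk (measurable_snd.fst.prodMk measurable_snd.snd.snd)).prodMk
      (measurable_fst.fst.prodMk measurable_snd.snd.fst)
  simpa only [Function.comp_def] using hg.comp he

end LinkKernel

end Summit.QuantumFields.YangMills.Cruxes.DiagonalMirrorRPR.SignTwistedDiagonalTrace.WilsonDiagonal

end
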